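import Mathlib
import HarnessLib
import Literature.MathematicalPhysics.KineticTheory.VelocityFlipNoise
import Literature.MathematicalPhysics.KineticTheory.VelocityFlipEmbeddedChainSteadyState
import Literature.Probability.Process.HarrisTheorem
import Summits.AtomisticToContinuum.FouriersLaw.Theorems.BondHeatUncertaintySubdiffusiveBondHeatKernelGibbsE
import Summits.AtomisticToContinuum.FouriersLaw.Theorems.JunctionLocalitySuperadditiveResistanceDeviceGibbs
import Summits.AtomisticToContinuum.FouriersLaw.Theorems.VanishingNoiseTransferVanishingNoiseBoundFlipMildContinuityResolvent
import Summits.AtomisticToContinuum.FouriersLaw.Theorems.VanishingNoiseTransferVanishingNoiseBoundFlipMildContinuityDifference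

/-!
# Stub CONT `stub_flipMildContinuity`: the Gibbs pairings of the centred mild forward family are continuous at `δ = 0`
(crux stmt-AtomisticToContinuum-11976 `VanishingNoiseBound`, line `fekete-usc-one-length`, wave 5)

`--supports stmt-AtomisticToContinuum-11976` file PROVING the registered stub `stub_flipMildContinuity` (clause (iv) of the
derivative-free hypothesis `FF''(ε)` of the dual Kubo road, `flip_dualForwardFields_of_stubs` in the skeleton
`Cruxes/VanishingNoiseBound/Lines/fekete_usc_one_length.lean`). For `pinnedChain ω₂ lam β γ` (all parameters `> 0`),
`L ≥ 2`, `T > 0`, `ε > 0`: if `g δ` (`0 < |δ| < δ₁ ≤ T`) is ANY measurable `e^{H/4T}`-bounded solution of the centred mild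
equation `g δ = R^δ(ψ_δ + Q g δ)` at bath temperatures `(T + δ/2, T − δ/2)` (`R^δ` the resolvent kernel at rate `Lε` of
the flip-free dynamics, `ψ_δ = (Lε)⁻¹((p_0² − T) − c δ)`, `Q` the flip average), `g₀` is a CONTINUOUS `e^{H/4T}`-bounded
solution at `(T, T)` with constant `c₀`, and `c δ → c₀` (`δ → 0`, `δ ≠ 0`), then
`∫ g δ · (p_b² − T) dμ_T → ∫ g₀ · (p_b² − T) dμ_T` for `b = 0, L − 1`.

Proof (perturbation of a Poisson equation for the embedded flip chain `K_δ = R^δ Q`): with the weight exponent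
`θ = (1/(4T) + 1/(T + δ₁/2))/2`, the δ-UNIFORM Harris data on the temperature range `[T − δ₁/2, T + δ₁/2]`
(`flip_uniformHarris`) and the weighted continuity `‖(R^δ − R^0) f₀‖_θ → 0` of the resolvent on the continuous source
`f₀ = ψ₀ + Q g₀` (`resolvent_continuous_temps_weighted`, both in `…FlipMildContinuityResolvent`) make the right-hand side
of the fixed-temperature pairing estimate `mild_difference_pairing_le` (`…FlipMildContinuityDifference`) tend to `0`.

* `abs_mildSource_le` — `|f₀| ≤ C e^{H/(4T)}`;
* `mild_pairing_tendsto` — the statement for a general site `b`;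
* `stub_flipMildContinuity` — the registered stub (sites `0` and `L − 1`, `kin_eq_sq`).

References: Hairer–Mattingly 2011; Meyn–Tweedie Ch. 16–17; Cuneo–Eckmann–Hairer–Rey-Bellet 2018 §3; Bernardin–Olla 2011.
-/

noncomputable section

open MeasureTheory ProbabilityTheory Filter Topology Set
open scoped NNReal ENNReal Topology
open Literature.MathematicalPhysics.KineticTheory.HeatConduction Literature.Probability.Process OscillatorChain
open Summit.AtomisticToContinuum.FouriersLaw.Theorems.SubdiffusiveBondHeat (abs_sq_momentum_sub_le_exp)

namespace Summit.AtomisticToContinuum.FouriersLaw.Theorems.VanishingNoiseBound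

variable {ω₂ lam β γ : ℝ} {N : ℕ}

/-- The flip-averaged source `f₀ = r⁻¹((p_0² − T) − c₀) + Q g₀` of the centred mild equation is `e^{H/4T}`-bounded:
`|f₀| ≤ (r⁻¹(8T + T + |c₀|) + |C|) e^{H/(4T)}` if `|g₀| ≤ C e^{H/(4T)}` (`r > 0`, `T > 0`). [folklore] -/
theorem abs_mildSource_le (hω : 0 < ω₂) (hl : 0 ≤ lam) (hβ : 0 ≤ β) (hN : 0 < N) {T : ℝ} (hT : 0 < T)
    {r : ℝ} (hr : 0 < r) (c₀ : ℝ) {g₀ : PhaseSpace N → ℝ} {C : ℝ}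
    (hg₀b : ∀ z, |g₀ z| ≤ C * Real.exp (1 / (4 * T) * (pinnedChain ω₂ lam β γ).hamiltonian N z))
    (y : PhaseSpace N) :
    |r⁻¹ * ((y.2 ⟨0, hN⟩ ^ 2 - T) - c₀) + (N : ℝ)⁻¹ * ∑ i : Fin N, g₀ (momentumFlip i y)| ≤
      (r⁻¹ * (2 / (1 / (4 * T)) + T + |c₀|) + |C|) *
        Real.exp (1 / (4 * T) * (pinnedChain ω₂ lam β γ).hamiltonian N y) := by
  set ex := Real.exp (1 / (4 * T) * (pinnedChain ω₂ lam β γ).hamiltonian N y) with hex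
  have hθ : 0 < 1 / (4 * T) := by positivity
  have h1 := abs_sq_momentum_sub_le_exp (γ := γ) hω hl hβ hθ hT.le y ⟨0, hN⟩
  have hex1 : 1 ≤ ex := Real.one_le_exp (mul_nonneg hθ.le (pinnedChain_hamiltonian_nonneg hω.le hl hβ γ N y))
  -- the flip average
  have hQ : |(N : ℝ)⁻¹ * ∑ i : Fin N, g₀ (momentumFlip i y)| ≤ |C| * ex := by
    rw [abs_mul, abs_of_pos (by positivity : (0 : ℝ) < (N : ℝ)⁻¹)]
    calc (N : ℝ)⁻¹ * |∑ i : Fin N, g₀ (momentumFlip i y)| ≤ (N : ℝ)⁻¹ * ∑ i : Fin N, |g₀ (momentumFlip i y)| :=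
          mul_le_mul_of_nonneg_left (Finset.abs_sum_le_sum_abs _ _) (by positivity)
      _ ≤ (N : ℝ)⁻¹ * ∑ _i : Fin N, |C| * ex := by
          refine mul_le_mul_of_nonneg_left (Finset.sum_le_sum fun i _ => ?_) (by positivity)
          have := hg₀b (momentumFlip i y)
          rw [OscillatorChain.hamiltonian_momentumFlip] at this
          exact this.trans (mul_le_mul_of_nonneg_right (le_abs_self C) (Real.exp_pos _).le)
      _ = |C| * ex := by
          rw [Finset.sum_const, Finset.card_univ, Fintype.card_fin, nsmul_eq_mul]
          field_simp
  have hψ : |r⁻¹ * ((y.2 ⟨0, hN⟩ ^ 2 - T) - c₀)| ≤ r⁻¹ * (2 / (1 / (4 * T)) + T + |c₀|) * ex := by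
    rw [abs_mul, abs_of_pos (inv_pos.2 hr), mul_assoc]
    refine mul_le_mul_of_nonneg_left ?_ (inv_pos.2 hr).le
    calc |y.2 ⟨0, hN⟩ ^ 2 - T - c₀| ≤ |y.2 ⟨0, hN⟩ ^ 2 - T| + |c₀| := abs_sub _ _
      _ ≤ (2 / (1 / (4 * T)) + T) * ex + |c₀| * 1 := by rw [mul_one]; exact add_le_add h1 le_rfl
      _ ≤ (2 / (1 / (4 * T)) + T) * ex + |c₀| * ex := by gcongr
      _ = (2 / (1 / (4 * T)) + T + |c₀|) * ex := by ring
  calc |r⁻¹ * ((y.2 ⟨0, hN⟩ ^ 2 - T) - c₀) + (N : ℝ)⁻¹ * ∑ i : Fin N, g₀ (momentumFlip i y)|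
      ≤ |r⁻¹ * ((y.2 ⟨0, hN⟩ ^ 2 - T) - c₀)| + |(N : ℝ)⁻¹ * ∑ i : Fin N, g₀ (momentumFlip i y)| := abs_add_le _ _
    _ ≤ r⁻¹ * (2 / (1 / (4 * T)) + T + |c₀|) * ex + |C| * ex := add_le_add hψ hQ
    _ = (r⁻¹ * (2 / (1 / (4 * T)) + T + |c₀|) + |C|) * ex := by ring

set_option maxHeartbeats 1600000 in
/-- **Continuity of the Gibbs pairings of the centred mild forward family at `δ = 0` (one site).** The content of
stub CONT for a general site `b`: under the hypotheses of `stub_flipMildContinuity`,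
`∫ g δ · (p_b² − T) dμ_T → ∫ g₀ · (p_b² − T) dμ_T` as `δ → 0`, `δ ≠ 0`. Proof: with the weight exponent
`θ = (1/(4T) + 1/(T + δ₁/2))/2`, uniform Harris data for the embedded flip chain on the temperature range
`[T − δ₁/2, T + δ₁/2]` (`flip_uniformHarris`), the weighted resolvent-difference bound for the continuous source
`f₀ = ψ₀ + Q g₀` (`resolvent_continuous_temps_weighted`) and `c δ → c₀` make the right-hand side of the pairing
estimate `mild_difference_pairing_le` small. [cite: HairerMattingly2011, Theorem 1.3] -/
theorem mild_pairing_tendsto (hω : 0 < ω₂) (hl : 0 < lam) (hβ : 0 < β) (hγ : 0 < γ) {L : ℕ} (hL : 2 ≤ L)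
    {T : ℝ} (hT : 0 < T) {ε : ℝ} (hε : 0 < ε) {g : ℝ → PhaseSpace L → ℝ} {c : ℝ → ℝ} {g₀ : PhaseSpace L → ℝ}
    {c₀ δ₁ : ℝ} (hδ₁ : 0 < δ₁) (hδ₁T : δ₁ ≤ T) (hc : Tendsto c (𝓝[≠] 0) (𝓝 c₀)) (hg₀c : Continuous g₀)
    (hg₀b : ∃ C : ℝ, ∀ z, |g₀ z| ≤ C * Real.exp (1 / (4 * T) * (pinnedChain ω₂ lam β γ).hamiltonian L z))
    (hg₀eq : ∀ z, g₀ z = ∫ y, (((L : ℝ) * ε)⁻¹ * ((y.2 ⟨0, by omega⟩ ^ 2 - T) - c₀) +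
        (L : ℝ)⁻¹ * ∑ i : Fin L, g₀ (momentumFlip i y))
      ∂((pinnedChainSemigroup hω hl.le hβ.le hγ.le (by omega) hT.le hT.le).resolventKernel ((L : ℝ) * ε) z))
    (hfam : ∀ (δ : ℝ) (hTL : 0 < T + δ / 2) (hTR : 0 < T - δ / 2), 0 < |δ| → |δ| < δ₁ →
      Measurable (g δ) ∧
      (∃ C : ℝ, ∀ z, |g δ z| ≤ C * Real.exp (1 / (4 * T) * (pinnedChain ω₂ lam β γ).hamiltonian L z)) ∧
      ∀ z, g δ z = ∫ y, (((L : ℝ) * ε)⁻¹ * ((y.2 ⟨0, by omega⟩ ^ 2 - T) - c δ) +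
          (L : ℝ)⁻¹ * ∑ i : Fin L, g δ (momentumFlip i y))
        ∂((pinnedChainSemigroup hω hl.le hβ.le hγ.le (by omega) hTL.le hTR.le).resolventKernel ((L : ℝ) * ε) z))
    (b : Fin L) :
    Tendsto (fun δ => ∫ x, g δ x * (x.2 b ^ 2 - T) ∂((pinnedChain ω₂ lam β γ).gibbsMeasure L T)) (𝓝[≠] 0)
      (𝓝 (∫ x, g₀ x * (x.2 b ^ 2 - T) ∂((pinnedChain ω₂ lam β γ).gibbsMeasure L T))) := by
  have hL0 : 0 < L := by omega
  have hL1 : 1 < L := by omega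
  set P := pinnedChain ω₂ lam β γ with hP
  set H : PhaseSpace L → ℝ := P.hamiltonian L with hH
  have hH0 : ∀ x, 0 ≤ H x := fun x => pinnedChain_hamiltonian_nonneg hω.le hl.le hβ.le γ L x
  set μ := P.gibbsMeasure L T with hμ
  set r : ℝ := (L : ℝ) * ε with hr_def
  have hr : 0 < r := by positivity
  -- the weight exponent and the temperature range
  set θ : ℝ := (1 / (4 * T) + 1 / (T + δ₁ / 2)) / 2 with hθ
  have hTδ : 0 < T + δ₁ / 2 := by positivity
  have h4 : 1 / (4 * T) < 1 / (T + δ₁ / 2) := by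
    rw [div_lt_div_iff₀ (by positivity) hTδ]; nlinarith
  have hθ1 : 1 / (4 * T) < θ := by rw [hθ]; linarith
  have hθ2 : θ < 1 / (T + δ₁ / 2) := by rw [hθ]; linarith
  have hθ0 : 0 < θ := lt_trans (by positivity) hθ1
  have hθT : θ < 1 / T := hθ2.trans_le (one_div_le_one_div_of_le hT (by linarith))
  set Tmin : ℝ := T - δ₁ / 2 with hTmin
  set Tmax : ℝ := T + δ₁ / 2 with hTmax
  have hTmin0 : 0 < Tmin := by rw [hTmin]; linarith
  have hmm : Tmin ≤ Tmax := by rw [hTmin, hTmax]; linarith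
  obtain ⟨γ₀, K₀, abar, βh, hγ₀, habar0, habar1, hβh, hpkg⟩ :=
    flip_uniformHarris (N := L) hω hl hβ hγ hL1 hTmin0 hmm hθ0 hθ2 hr
  obtain ⟨hdR0, -, -⟩ := hpkg T T hT hT (by rw [hTmin]; linarith) (by rw [hTmax]; linarith)
    (by rw [hTmin]; linarith) (by rw [hTmax]; linarith)
  -- the source and its normalisation
  obtain ⟨Cg, hCg⟩ := hg₀b
  set f₀ : PhaseSpace L → ℝ := fun y => r⁻¹ * ((y.2 ⟨0, hL0⟩ ^ 2 - T) - c₀) +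
    (L : ℝ)⁻¹ * ∑ i : Fin L, g₀ (momentumFlip i y) with hf₀
  have hf₀c : Continuous f₀ := by
    rw [hf₀]
    refine Continuous.add (by fun_prop) (continuous_const.mul (continuous_finsetSum _ fun i _ =>
      hg₀c.comp (continuous_momentumFlip i)))
  set Cf : ℝ := (r⁻¹ * (2 / (1 / (4 * T)) + T + |c₀|) + |Cg|) + 1 with hCf
  have hCf0 : 0 < Cf := by rw [hCf]; positivity
  have hf₀b : ∀ y, |f₀ y| ≤ Cf * Real.exp (1 / (4 * T) * H y) := fun y =>
    (abs_mildSource_le (γ := γ) hω hl.le hβ.le hL0 hT hr c₀ hCg y).trans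
      (mul_le_mul_of_nonneg_right (by rw [hCf]; linarith) (Real.exp_pos _).le)
  set f : PhaseSpace L → ℝ := fun y => f₀ y / Cf with hf
  have hfc : Continuous f := hf₀c.div_const Cf
  have hfb : ∀ y, |f y| ≤ Real.exp (1 / (4 * T) * H y) := fun y => by
    rw [hf]; dsimp only
    rw [abs_div, abs_of_pos hCf0, div_le_iff₀ hCf0, mul_comm]
    exact hf₀b y
  have hff₀ : ∀ y, f₀ y = Cf * f y := fun y => by rw [hf]; dsimp only; field_simp
  -- the constants of the final estimate
  set IV : ℝ := ∫ x, Real.exp (θ * H x) * |x.2 b ^ 2 - T| ∂μ with hIV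
  have hIV0 : 0 ≤ IV := integral_nonneg fun x => mul_nonneg (Real.exp_pos _).le (abs_nonneg _)
  have hγ₀r : (γ₀ : ℝ) < 1 := by exact_mod_cast hγ₀
  set CH : ℝ := (2 + βh + βh * (K₀ / (1 - γ₀))) / (βh * (1 - abar)) with hCH
  have hCH0 : 0 ≤ CH := by
    rw [hCH]
    have : 0 ≤ (K₀ : ℝ) / (1 - γ₀) := div_nonneg K₀.coe_nonneg (by linarith)
    have : 0 < 1 - abar := by linarith
    positivity
  set Cst : ℝ := CH * (Cf + r⁻¹) * IV with hCst
  have hCst0 : 0 ≤ Cst := by positivity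
  -- ε-δ
  rw [Metric.tendsto_nhdsWithin_nhds]
  intro e he
  set e₁ : ℝ := e / (2 * (Cst + 1)) with he₁
  have he₁0 : 0 < e₁ := by positivity
  obtain ⟨δA, hδA, hA⟩ := resolvent_continuous_temps_weighted (N := L) hω hl hβ hγ hL1 hT hr hfc hfb hθ1 he₁0
  obtain ⟨δB, hδB, hB⟩ := Metric.tendsto_nhdsWithin_nhds.1 hc e₁ he₁0
  refine ⟨min (min δA δB) δ₁, lt_min (lt_min hδA hδB) hδ₁, fun {δ} hδ0 hδd => ?_⟩
  have hδne : δ ≠ 0 := hδ0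
  rw [Real.dist_eq, sub_zero] at hδd
  have hδA' : |δ| < δA := hδd.trans_le ((min_le_left _ _).trans (min_le_left _ _))
  have hδB' : |δ| < δB := hδd.trans_le ((min_le_left _ _).trans (min_le_right _ _))
  have hδ1 : |δ| < δ₁ := hδd.trans_le (min_le_right _ _)
  have habs : 0 < |δ| := abs_pos.2 hδne
  have hδlt := abs_lt.1 hδ1
  have hTL : 0 < T + δ / 2 := by linarith
  have hTR : 0 < T - δ / 2 := by linarith
  obtain ⟨hgm, ⟨Cδ, hgδb⟩, hgeq⟩ := hfam δ hTL hTR habs hδ1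
  obtain ⟨hdR, hdK, hcontr⟩ := hpkg (T + δ / 2) (T - δ / 2) hTL hTR (by rw [hTmin]; linarith)
    (by rw [hTmax]; linarith) (by rw [hTmin]; linarith) (by rw [hTmax]; linarith)
  have hθLR : θ < 1 / max (T + δ / 2) (T - δ / 2) :=
    hθ2.trans_le (one_div_le_one_div_of_le (lt_max_of_lt_left hTL) (max_le (by linarith) (by linarith)))
  -- the resolvent-difference bound for `f₀`
  have hAδ := hA (T + δ / 2) (T - δ / 2) hTL hTR
    (by rw [show T + δ / 2 - T = δ / 2 by ring, abs_div, abs_two]; linarith)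
    (by rw [show T - δ / 2 - T = -(δ / 2) by ring, abs_neg, abs_div, abs_two]; linarith)
  have hdiff : ∀ z, |∫ y, f₀ y ∂((pinnedChainSemigroup hω hl.le hβ.le hγ.le hL0 hTL.le hTR.le).resolventKernel r z) -
      ∫ y, f₀ y ∂((pinnedChainSemigroup hω hl.le hβ.le hγ.le hL0 hT.le hT.le).resolventKernel r z)| ≤
      Cf * e₁ * Real.exp (θ * H z) := by
    intro z
    have h1 := hAδ z
    simp_rw [hff₀]
    rw [integral_const_mul, integral_const_mul, ← mul_sub, abs_mul, abs_of_pos hCf0, mul_assoc]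
    exact mul_le_mul_of_nonneg_left h1 hCf0.le
  have hcδ : |c δ - c₀| < e₁ := by
    have := hB hδ0 (by rwa [Real.dist_eq, sub_zero])
    rwa [Real.dist_eq] at this
  -- the pairing estimate
  have key := mild_difference_pairing_le hω hl hβ hγ hL1 hT hε hTL hTR hθ1.le hθT hθLR hγ₀ habar0 habar1 hβh
    hdR hdK hdR0 hcontr hgm hg₀c.measurable hgδb hCg hgeq hg₀eq (by positivity : 0 ≤ Cf * e₁) hdiff b
  rw [Real.dist_eq]
  refine key.trans_lt ?_
  calc CH * (Cf * e₁ + r⁻¹ * |c δ - c₀|) * IV ≤ CH * (Cf * e₁ + r⁻¹ * e₁) * IV := by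
        gcongr
    _ = Cst * e₁ := by rw [hCst]; ring
    _ ≤ e / 2 := by
        rw [he₁, mul_div_assoc', div_le_div_iff₀ (by positivity) (by positivity)]
        nlinarith
    _ < e := half_lt_self he

/-- **Stub CONT · flipMildContinuity (crux stmt-AtomisticToContinuum-11976, line `fekete-usc-one-length`).** The Gibbs
pairings `∫ g δ · (p_b² − T) dμ_T` (`b = 0, L − 1`) of the centred mild forward family at bath temperatures
`(T + δ/2, T − δ/2)` converge, as `δ → 0` along `δ ≠ 0`, to those of the continuous mild solution `g₀` at `(T, T)`
(`mild_pairing_tendsto` at the two end sites, `kin_eq_sq`). -/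
theorem stub_flipMildContinuity :
    ∀ (ω₂ lam β γ : ℝ) (hω : 0 < ω₂) (hl : 0 < lam) (hβ : 0 < β) (hγ : 0 < γ) (L : ℕ) (hL : 2 ≤ L)
      (T : ℝ) (hT : 0 < T) (ε : ℝ), 0 < ε →
      ∀ (g : ℝ → PhaseSpace L → ℝ) (c : ℝ → ℝ) (g₀ : PhaseSpace L → ℝ) (c₀ δ₁ : ℝ), 0 < δ₁ → δ₁ ≤ T →
      Tendsto c (𝓝[≠] 0) (𝓝 c₀) → Continuous g₀ →
      (∃ C : ℝ, ∀ z, |g₀ z| ≤ C * Real.exp (1 / (4 * T) * (pinnedChain ω₂ lam β γ).hamiltonian L z)) →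
      (∀ z, g₀ z = ∫ y, (((L : ℝ) * ε)⁻¹ * ((y.2 ⟨0, by omega⟩ ^ 2 - T) - c₀) +
          (L : ℝ)⁻¹ * ∑ i : Fin L, g₀ (momentumFlip i y))
        ∂((pinnedChainSemigroup hω hl.le hβ.le hγ.le (by omega) hT.le hT.le).resolventKernel
          ((L : ℝ) * ε) z)) →
      (∀ (δ : ℝ) (hTL : 0 < T + δ / 2) (hTR : 0 < T - δ / 2), 0 < |δ| → |δ| < δ₁ →
        Measurable (g δ) ∧
        (∃ C : ℝ, ∀ z, |g δ z| ≤ C * Real.exp (1 / (4 * T) * (pinnedChain ω₂ lam β γ).hamiltonian L z)) ∧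
        ∀ z, g δ z = ∫ y, (((L : ℝ) * ε)⁻¹ * ((y.2 ⟨0, by omega⟩ ^ 2 - T) - c δ) +
            (L : ℝ)⁻¹ * ∑ i : Fin L, g δ (momentumFlip i y))
          ∂((pinnedChainSemigroup hω hl.le hβ.le hγ.le (by omega) hTL.le hTR.le).resolventKernel
            ((L : ℝ) * ε) z)) →
      Tendsto (fun δ => ∫ x, g δ x * (Theorems.SuperadditiveResistance.DeviceLiouville.kin L 0 x - T)
          ∂((pinnedChain ω₂ lam β γ).gibbsMeasure L T)) (𝓝[≠] 0)
        (𝓝 (∫ x, g₀ x * (Theorems.SuperadditiveResistance.DeviceLiouville.kin L 0 x - T)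
          ∂((pinnedChain ω₂ lam β γ).gibbsMeasure L T))) ∧
      Tendsto (fun δ => ∫ x, g δ x * (Theorems.SuperadditiveResistance.DeviceLiouville.kin L (L - 1) x - T)
          ∂((pinnedChain ω₂ lam β γ).gibbsMeasure L T)) (𝓝[≠] 0)
        (𝓝 (∫ x, g₀ x * (Theorems.SuperadditiveResistance.DeviceLiouville.kin L (L - 1) x - T)
          ∂((pinnedChain ω₂ lam β γ).gibbsMeasure L T))) := by
  intro ω₂ lam β γ hω hl hβ hγ L hL T hT ε hε g c g₀ c₀ δ₁ hδ₁ hδ₁T hc hg₀c hg₀b hg₀eq hfam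
  have hL0 : 0 < L := by omega
  have hLL : L - 1 < L := by omega
  have key := fun b : Fin L => mild_pairing_tendsto hω hl hβ hγ hL hT hε hδ₁ hδ₁T hc hg₀c hg₀b hg₀eq hfam b
  constructor
  · simp_rw [Theorems.SuperadditiveResistance.DeviceLiouville.kin_eq_sq hL0]
    exact key ⟨0, hL0⟩
  · simp_rw [Theorems.SuperadditiveResistance.DeviceLiouville.kin_eq_sq hLL]
    exact key ⟨L - 1, hLL⟩


end Summit.AtomisticToContinuum.FouriersLaw.Theorems.VanishingNoiseBound

end
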